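import Summits.Ventures.PercRepro.RankLevelSetUpFiveTargets

/-! # RankLevelSetUpFiveCount — THE NUMBER OF TYPE-B TARGETS OF A BAD MEMBER (night-1 g41; dossier §53.5; on
`RankLevelSetUpFiveTargets`)

The type-B targets of a bad member `W` (line points `L'`, coloops `C`, `R := W ∖ b`, `H := cl R`) are the pairs
`(Z, t)` with `Z = R ∪ {ℓ, c}` for a valid `c ∈ C` and `ℓ ∈ Λ(W, c) = {ℓ ∈ L' : {ℓ, c} ⊄ H}`, and `t ∈ C ∖ c`
(**`typeBTargets`**). For one valid `c` the map `(ℓ, t) ↦ (R ∪ {ℓ, c}, t)` is injective on `Λ(W, c) × (C ∖ c)`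
(`ℓ` is the only point of `Z` on the line: **`typeB_inj`**), so **`ncard_typeBTargets_ge`**:
`#typeBTargets ≥ #Λ(W, c) · #(C ∖ c) = 2 #Λ(W, c)`, the degree bound `deg_B(W) ≥ 2 (n − 10 + s)` of §53.5 once
`#Λ ≥ n − 10 + s` (`RankLevelSetUpFiveDegree`) and `#C = 3`. Every declaration has a docstring; imports: the
cell's own modules and Mathlib only. Axioms: standard. -/

namespace PercRepro

open Set Matroid

variable {α : Type}

/-- **The type-B targets of a bad member**: the pairs `(Z, t)` with `Z = R ∪ {ℓ, c}`, `ℓ ∈ L'`, `c ∈ C` valid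
(`b ∉ cl (L' ∪ (C ∖ c))`), `{ℓ, c} ⊄ cl R`, `t ∈ C ∖ c`. -/
def typeBTargets (N : Matroid α) (R L' C : Set α) (b : α) : Set (Set α × α) :=
  {p | ∃ ℓ ∈ L', ∃ c ∈ C, b ∉ N.closure (L' ∪ (C \ {c})) ∧ ¬ ({ℓ, c} ⊆ N.closure R) ∧
    p.1 = R ∪ {ℓ, c} ∧ p.2 ∈ C \ {c}}

/-- **The target map of a fixed valid coloop is injective on the line points**: for `R` disjoint from `L'` and
`c ∉ L'`, `R ∪ {ℓ, c} = R ∪ {ℓ', c}` with `ℓ ∈ L'` forces `ℓ = ℓ'`. -/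
lemma typeB_inj {R L' : Set α} (hRL : Disjoint R L') {c : α} (hcL : c ∉ L') {ℓ ℓ' : α} (hℓ : ℓ ∈ L')
    (h : R ∪ {ℓ, c} = R ∪ {ℓ', c}) : ℓ = ℓ' := by
  have hmem : ℓ ∈ R ∪ {ℓ', c} := h ▸ Set.mem_union_right R (Set.mem_insert ℓ {c})
  rcases hmem with hR | hlc
  · exact absurd hℓ (hRL.notMem_of_mem_left hR)
  · rcases hlc with h1 | h1
    · exact h1
    · rw [Set.mem_singleton_iff] at h1
      exact absurd (h1 ▸ hℓ) hcL

/-- **THE NUMBER OF TYPE-B TARGETS IS AT LEAST `#Λ(W, c) · #(C ∖ c)`** for every valid `c ∈ C` (night-1 g41,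
§53.5): `R` disjoint from `L'`, `C` disjoint from `L'`, `N` finite. -/
theorem ncard_typeBTargets_ge {N : Matroid α} [N.Finite] {R L' C : Set α} {b : α} (hLE : L' ⊆ N.E)
    (hCE : C ⊆ N.E) (hRL : Disjoint R L') (hCL : Disjoint C L') {c : α} (hc : c ∈ C)
    (hval : b ∉ N.closure (L' ∪ (C \ {c}))) :
    {ℓ ∈ L' | ¬ ({ℓ, c} ⊆ N.closure R)}.ncard * (C \ {c}).ncard ≤ (typeBTargets N R L' C b).ncard := by
  classical
  set Λ := {ℓ ∈ L' | ¬ ({ℓ, c} ⊆ N.closure R)} with hΛ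
  have hΛfin : Λ.Finite := (N.ground_finite.subset hLE).subset (fun x hx => hx.1)
  have hCfin : (C \ {c}).Finite := (N.ground_finite.subset hCE).subset Set.sdiff_subset
  -- the target set is finite: it sits inside `𝒫(E) × E`
  have hTfin : (typeBTargets N R L' C b).Finite := by
    have himg : ((fun q : α × α => R ∪ {q.1, q.2}) '' (L' ×ˢ C)).Finite :=
      ((N.ground_finite.subset hLE).prod (N.ground_finite.subset hCE)).image _
    refine (himg.prod (N.ground_finite.subset hCE)).subset ?_
    rintro ⟨Z, t⟩ ⟨ℓ, hℓ, c', hc', -, -, hZ, ht⟩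
    exact ⟨⟨(ℓ, c'), ⟨hℓ, hc'⟩, hZ.symm⟩, ht.1⟩
  rw [← Set.ncard_prod]
  refine Set.ncard_le_ncard_of_injOn (fun p => (R ∪ {p.1, c}, p.2)) ?_ ?_ hTfin
  · rintro ⟨ℓ, t⟩ ⟨hℓ, ht⟩
    exact ⟨ℓ, hℓ.1, c, hc, hval, hℓ.2, rfl, ht⟩
  · rintro ⟨ℓ, t⟩ ⟨hℓ, -⟩ ⟨ℓ', t'⟩ ⟨hℓ', -⟩ heq
    simp only [Prod.mk.injEq] at heq
    obtain ⟨h1, h2⟩ := heq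
    have : ℓ = ℓ' := typeB_inj hRL (hCL.notMem_of_mem_left hc) hℓ.1 h1
    rw [this, h2]

end PercRepro
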